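import Summits.BirchSwinnertonDyer.Rank1Residual.Additive.KodairaDictionaryThree
import Summits.BirchSwinnertonDyer.Rank1Residual.GaloisImage.NineTowerOfJWitness
import HarnessLib

/-!
# The EXOTIC residue of X4 at `3` after the level-`9` Tate criterion: wild cell (w) AND no
# `j`-witness at level `9` — every prime `q ≠ 3` with `ord_q j < 0` has `9 ∣ ord_q j`
# (cell `b2b-bsdres`, team n1011, seat p14 gen 2 — row T-b10 'wild tower at 3', ARM B, target T3 of
# `cells/n1011/skel/T-b9x-nine.md`; sequel of `Additive/KodairaDictionaryThree.lean` p258037 and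
# `GaloisImage/NineTowerOfJWitness.lean`)

HONEST FRAMING (cell `b2b-bsdres`, run/shared/lean/b2b/bsd-rank1-residual/, verbatim in every
file): the goal of the cell is to DELETE the COMBINATION-SHAPED residual classes of the
Birch–Swinnerton-Dyer formula for ALL analytic-rank `≤ 1` elliptic curves over `ℚ` — "full BSD
formula for every rank `≤ 1` curve in class `C`" assembled STRICTLY from published theorems — so
that the rank-`≤ 1` remainder becomes exactly the CONSTRUCTION-SHAPED classes, which are TYPED
(missing-input `Prop`s), NOT attempted. This is not "finishing BSD". Team n1011 (N10 / N11, the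
additive block X4 ∧ `p = 3`): research route; no claim beyond the stated classes; the label X4 is
UNCHANGED by this file; nothing is booked. Theorems only (no definition, no named fact minted; every
published input of the end-state is an explicit named-fact hypothesis, as in p250513 / p251574).

## What this file proves

* `ClassX4.towerSurj_three_of_surj_of_jWitness_nine` — X4 at `3`, surj(3), and a prime `q ≠ 3` with
  `ord_q j < 0`, `9 ∤ ord_q j` ⟹ the `3`-adic tower (T2, any Kodaira type at `3`).
* `ClassX4.exotic_signature_of_not_towerSurj_three` — **THE EXOTIC SIGNATURE**: an X4 pair at `3`
  with `ρ̄_{E,3}` onto whose tower fails lies in the wild cell (w) (`SubW W 3`: `ord₃ j ≥ 0`,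
  `f₃ ≠ 2`, Kodaira `II/IV/IV*/II*`) AND has `9 ∣ ord_q j(E)` at every prime `q ≠ 3` with
  `ord_q j(E) < 0` (in particular `9 ∣ v_ℓ(Δ_min)` at every multiplicative `ℓ`).
* `exotic_iff_exotic_of_signature` and the END-STATE
  **`x4SharpUnitFree_iff_lower_and_residues_sharp_exoticNine_noL20`** — p251574's eight-fact X4
  end-state with the EXOTIC piece quantified ONLY over the rows carrying that signature.

Census reading (EVIDENCE, `HOME/b2b-bsdres-n1011-p14/e9/ram9_reach.json`, Cremona a-invariants, 0
disagreements with the census ram bit): of the 20 970 surj(3) wild X4@3 `r_an = 0` cells the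
signature (no level-9 `j`-witness) holds on exactly the 1 141 'cert-needed ∧ ¬ram9 ∧ ¬jwit9' cells
(II 273 / IV 232 / IV* 310 / II* 326) — the EXOTIC hypothesis now bears on those alone; Elkies'
9-deficient curves (arXiv:math/0612734) are among them by `nine_dvd_padicValRat_j_of_surj_of_not_towerSurj_three`.
Nothing booked; X4 CONSTRUCTION-SHAPED; no label change.

References: [Wuthrich2014] Lemma 20 (p. 399); [SerreAbelianLadic1968] IV §3.4, A.1.2;
[SilvermanATAEC1994] V.5.3, Ex. 5.13(b); [Elkies2006] arXiv:math/0612734; [Kato2004Asterisque]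
Thm. 14.5 (3).
-/

noncomputable section

open scoped Classical

open WeierstrassCurve Literature.NumberTheory.EllipticCurves
  Literature.NumberTheory.EllipticCurves.ModularForms
  Literature.NumberTheory.EllipticCurves.Rank1Residual
  Literature.NumberTheory.EllipticCurves.Rank1Residual.Typed
  Summit.BirchSwinnertonDyer.Rank1Residual.GaloisImage

namespace Summit.BirchSwinnertonDyer.Rank1Residual.Additive

section Signature

variable {W : WeierstrassCurve ℚ} [W.IsElliptic] [W.IsGloballyMinimal]

omit [W.IsGloballyMinimal] in
/-- **X4 at `3` + surj(3) + a level-`9` `j`-witness ⟹ the tower** (T2 in class currency; no Kodaira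
hypothesis at `3`). [cite: SerreAbelianLadic1968, Ch. IV §3.4, Lemma 3 and A.1.2]
[cite: SilvermanATAEC1994, V.5.3 and Exercise 5.13(b) (PDF p. 416)] -/
theorem ClassX4.towerSurj_three_of_surj_of_jWitness_nine [Fact (Nat.Prime 3)] (_hX : ClassX4 W 3)
    (hsurj : Surj W 3)
    (hJ : ∃ q : ℕ, q.Prime ∧ q ≠ 3 ∧ padicValRat q W.j < 0 ∧ ¬ (9 : ℤ) ∣ padicValRat q W.j)
    (n : ℕ) : W.HasSurjectiveModNGaloisRep (3 ^ n : ℕ) :=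
  Summit.BirchSwinnertonDyer.Rank1Residual.GaloisImage.towerSurj_three_of_surj_of_jWitness_nine W
    hsurj hJ n

/-- **THE EXOTIC SIGNATURE.**  An X4 pair at `3` with `ρ̄_{E,3}` onto whose `3`-adic tower fails is
in the wild census cell (w) (`ClassX4.subW_of_not_towerSurj_three`: `ord₃ j ≥ 0 ∧ f₃ ≠ 2`, i.e.
Kodaira `II/IV/IV*/II*`) and has NO level-`9` `j`-witness: `9 ∣ ord_q j(E)` for every prime `q ≠ 3`
with `ord_q j(E) < 0` (`nine_dvd_padicValRat_j_of_surj_of_not_towerSurj_three`).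
[cite: Elkies2006, §1] [cite: Wuthrich2014, Lemma 20 (p. 399)] -/
theorem ClassX4.exotic_signature_of_not_towerSurj_three [Fact (Nat.Prime 3)] (hX : ClassX4 W 3)
    (hsurj : Surj W 3) (hnot : ¬ ∀ n : ℕ, W.HasSurjectiveModNGaloisRep (3 ^ n : ℕ)) :
    SubW W 3 ∧ ∀ q : ℕ, q.Prime → q ≠ 3 → padicValRat q W.j < 0 → (9 : ℤ) ∣ padicValRat q W.j :=
  ⟨ClassX4.subW_of_not_towerSurj_three hX hsurj hnot,
    fun _ hq hq3 hneg ↦ nine_dvd_padicValRat_j_of_surj_of_not_towerSurj_three W hsurj hnot hq hq3 hneg⟩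

end Signature

/-! ### The X4 end-state with the EXOTIC piece on the signature rows only -/

/-- **The EXOTIC hypothesis of the end-state, RESTRICTED to the signature rows.**  p251574's EXOTIC
piece (`p = 3`, `r_an = 0`, X4, surj(3), `ord₃ j ≥ 0`, `¬ TypeG W 3`, tower fails ⟹ upper) is
EQUIVALENT to the same statement on the rows of the wild cell `SubW W 3` having `9 ∣ ord_q j` at
every prime `q ≠ 3` with `ord_q j < 0`. [cite: Wuthrich2014, Lemma 20 (p. 399)] [cite: Elkies2006, §1] -/
theorem exotic_iff_exotic_of_signature :
    (∀ (W : WeierstrassCurve ℚ) [W.IsElliptic] [W.IsGloballyMinimal],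
        W.analyticRank = 0 → ClassX4 W 3 → Surj W 3 → 0 ≤ padicValRat 3 W.j → ¬ TypeG W 3 →
        ¬ (∀ n : ℕ, W.HasSurjectiveModNGaloisRep (3 ^ n : ℕ)) → MissingUpperBoundAt W 3) ↔
    (∀ (W : WeierstrassCurve ℚ) [W.IsElliptic] [W.IsGloballyMinimal],
        W.analyticRank = 0 → ClassX4 W 3 → Surj W 3 → SubW W 3 →
        (∀ q : ℕ, q.Prime → q ≠ 3 → padicValRat q W.j < 0 → (9 : ℤ) ∣ padicValRat q W.j) →
        ¬ (∀ n : ℕ, W.HasSurjectiveModNGaloisRep (3 ^ n : ℕ)) → MissingUpperBoundAt W 3) := by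
  haveI : Fact (Nat.Prime 3) := ⟨Nat.prime_three⟩
  rw [exotic_iff_exotic_of_subW]
  constructor
  · intro h V _ _ hr hX hs hS _ hnot
    exact h V hr hX hs hS hnot
  · intro h V _ _ hr hX hs hS hnot
    exact h V hr hX hs hS (ClassX4.exotic_signature_of_not_towerSurj_three hX hs hnot).2 hnot

/-- **THE END-STATE OF CLASS X4 ON EIGHT NAMED FACTS with the EXOTIC piece on the SIGNATURE rows
only: X4♯(unit-free) ⟺ LOWER ∧ EXOTIC((w) ∧ no level-9 `j`-witness) ∧ TAM-DEFECT₂♭ ∧ ODD-SHA♭ ∧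
MANIN♭** — p251574's `x4SharpUnitFree_iff_lower_and_residues_sharp_exoticTypeG_noL20` rewritten
along `exotic_iff_exotic_of_signature`.  No named fact beyond the eight; X4 stays
CONSTRUCTION-SHAPED; nothing booked. [cite: Kato2004Asterisque, Thm. 14.5 (3) (p. 236), Thm. 17.4 (3) (p. 273)]
[cite: Delbourgo1998, Prop. 4 (p. 144)] [cite: Wuthrich2014, Lemma 20 (p. 399)] [cite: SilvermanAEC2009, Thm. X.4.14]
[cite: Kim2022StructureSelmer, Conj. 1.10 (PDF p. 8)] [cite: Miller2011LMS, Def. 1.1] [cite: Elkies2006, §1] -/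
theorem x4SharpUnitFree_iff_lower_and_residues_sharp_exoticNine_noL20
    (hCT : exists_casselsTate_pairing (K := ℚ))
    (hKatoS : Kato2004.rankZero_padicValNat_sha_le_sub_localTamagawa_of_additive_potGood_of_imageContainsSL2)
    (hDel : Delbourgo1998.prop4_rankZero_pow_dvd_constantCoeff)
    (hGZK : rank_eq_analyticRank_of_analyticRank_le_one) (hmod : hasEntireLFunction_rat)
    (hmodD : nonempty_modularParametrizationData)
    (hKatoχ : Wuthrich2014.kato_halfEigenCharIdeal_dvd_cyclotomicPrime_of_surjective)
    (hK : Kato2004.charIdeal_dvd_padicLFunctionBranch_component_of_surjective) :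
    X4SharpUnitFree ↔
      (∀ (W : WeierstrassCurve ℚ) [W.IsElliptic] [W.IsGloballyMinimal] (p : ℕ) [Fact p.Prime],
          W.analyticRank = 0 → ClassX4 W p → Surj W p → MissingLowerBoundAt W p) ∧
      (∀ (W : WeierstrassCurve ℚ) [W.IsElliptic] [W.IsGloballyMinimal],
          W.analyticRank = 0 → ClassX4 W 3 → Surj W 3 → SubW W 3 →
          (∀ q : ℕ, q.Prime → q ≠ 3 → padicValRat q W.j < 0 → (9 : ℤ) ∣ padicValRat q W.j) →
          ¬ (∀ n : ℕ, W.HasSurjectiveModNGaloisRep (3 ^ n : ℕ)) → MissingUpperBoundAt W 3) ∧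
      (∀ (W : WeierstrassCurve ℚ) [W.IsElliptic] [W.IsGloballyMinimal] (p : ℕ) [Fact p.Prime],
          W.analyticRank = 0 → ClassX4 W p → Surj W p → 0 ≤ padicValRat p W.j →
          ¬ (TypeGOrd W p ∧ semistabilityIndex W p = 2) →
          padicValNat p ((W.baseChange ℚ_[p]).localTamagawaNumber ℤ_[p]) + 2 ≤
            padicValNat p W.tamagawaProduct →
          MissingUpperBoundAt W p) ∧
      (∀ (W : WeierstrassCurve ℚ) [W.IsElliptic] [W.IsGloballyMinimal] (p : ℕ) [Fact p.Prime],
          W.analyticRank = 0 → ClassX4 W p → Surj W p → 0 ≤ padicValRat p W.j →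
          ¬ (TypeGOrd W p ∧ semistabilityIndex W p = 2) →
          (∃ q : ℚ, shaAn W = (q : ℂ) ∧ Odd (padicValRat p q)) → MissingUpperBoundAt W p) ∧
      (∀ (W : WeierstrassCurve ℚ) [W.IsElliptic] [W.IsGloballyMinimal] (p : ℕ) [Fact p.Prime],
          W.analyticRank = 0 → ClassX4 W p → Surj W p → 0 ≤ padicValRat p W.j →
          ¬ (TypeGOrd W p ∧ semistabilityIndex W p = 2) →
          (∀ (N : ℕ) [NeZero N] (D : ModularParametrizationData W N), (p : ℤ) ∣ D.maninConstant) →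
          MissingUpperBoundAt W p) := by
  rw [x4SharpUnitFree_iff_lower_and_residues_sharp_exoticTypeG_noL20 hCT hKatoS hDel hGZK hmod hmodD
    hKatoχ hK, exotic_iff_exotic_of_signature]

end Summit.BirchSwinnertonDyer.Rank1Residual.Additive

end
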